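import Mathlib
import Literature.AlgebraicGeometry.Resolution.PlaneGermBlowup
import Literature.AlgebraicGeometry.Resolution.PlaneGermBlowupCalculus
import Literature.AlgebraicGeometry.Resolution.FormalShear
import Literature.AlgebraicGeometry.Resolution.WeightedShear
import Summits.ResolutionOfSingularities.ResolutionOfSingularities.Theorems.WeightedInvariantLocalWeightedDropContactApprox
import Summits.ResolutionOfSingularities.ResolutionOfSingularities.Theorems.WeightedInvariantLocalWeightedDropApproxPowerExact

/-!
# `WeightedInvariant.LocalWeightedDrop`, line `hasse-ridge-face-selection`: persistent order ⇒ `m`-th power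

Crux item stmt-ResolutionOfSingularities-8899 (route `ResolutionOfSingularities/WeightedInvariant`),
skeleton v14 of the line `hasse-ridge-face-selection`, stub `stub_persistentOrderPower`, PROVED here
(statement verbatim from the ledger registration).

**Statement (the analytic heart of the strong embedded resolution of plane curve germs, any field `k`).**
Let `m ≥ 1` and let `h₀, h₁, … ∈ k[[x, y]]` (`x = X 0`, `y = X 1`) all have order `m`, each `h_{j+1}`
being the strict transform of `h_j` at the exceptional point of slope `T j`:
`h_j(x, x(T_j + y)) = x^m · h_{j+1}` (`PlaneGerm.dirChart`).  Then `h₀ = u · L^m` with `u(0) ≠ 0`,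
`L(0) = 0` and `∂L/∂y(0) ≠ 0`.

**Proof.**  Write `σ_J = (x, x^J y)`, `Ψ_J = ∑_{j<J} T_j x^{j+1}` and let `S_ψ = (x, y + ψ)` be the shears.
(1) ITERATE: `σ_J^* S_{Ψ_J}^* h₀ = x^{J m} · h_J` (`iterate`), by induction on `J` over the shifted
sequences, from `Ψ_{J+1}(T) = x Ψ_J(T∘succ) + T₀ x`, additivity of shears (`FormalShear.shear_shear`),
`σ_{J+1} = σ_1 ∘ σ_J` (`blowJ_blow`), the commutation `σ_1 ∘ S_{xψ} = S_ψ ∘ σ_1` for `ψ` in `x` only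
(`blow_shear`), and `dirChart t = σ_1 ∘ S_{t x}` (`PlaneGerm.subst_dirChart`).
(2) CONTACT: `σ_J` sends the monomial `(p, q)` to `(p + J q, q)` injectively, of degree the
`(1, J+1)`-weight of `(p, q)`; since `ord (x^{J m} h_J) = (J+1) m`, the `(1, J+1)`-weighted order of
`S_{Ψ_J}^* h₀` is `≥ (J+1) m` (`le_weightedOrder_of_blowJ`): contact `≥ N` for every `N` in the legal
coordinates `S_{Ψ_{N-1}}` (`contact`).
(3) The landed `stub_contactApprox` and `stub_approxPowerExact` turn this into `h₀ = u · L^m`, `u` a unit,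
`L(0) = 0`, some linear coefficient of `L` non-zero.
(4) `∂L/∂y(0) ≠ 0` (`coeff_y_ne_zero`): otherwise `L = a x + O(2)`, `a ≠ 0`, so
`L(x, x(T₀ + y)) = x · U` with `U(0) = a`, and `x^m h₁ = (u∘dirChart) x^m U^m` makes `h₁` a unit,
contradicting `ord h₁ = m ≥ 1`.
-/

set_option linter.dupNamespace false -- mandated namespace of this single-conjunct summit

namespace Summit.ResolutionOfSingularities.ResolutionOfSingularities.Theorems

open Literature.AlgebraicGeometry.Resolution

namespace PersistentOrderPower

open MvPowerSeries

variable {k : Type} [Field k]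

/-! ### The polynomials `Ψ_J = ∑_{j<J} T_j x^{j+1}` and substitutions fixing `x` -/

/-- A substitution fixing `x` commutes with multiplication by `x^m`. -/
theorem subst_X_pow_mul {a : Fin 2 → MvPowerSeries (Fin 2) k} (ha : HasSubst a) (ha0 : a 0 = X 0)
    (m : ℕ) (φ : MvPowerSeries (Fin 2) k) : subst a (X 0 ^ m * φ) = X 0 ^ m * subst a φ := by
  rw [subst_mul ha, subst_pow ha, subst_X ha, ha0]

/-- `Ψ_J` has no `y`-monomials. -/
theorem noY_psi (J : ℕ) (T : ℕ → k) :
    ∀ e : Fin 2 →₀ ℕ, e 1 ≠ 0 →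
      coeff e (∑ j ∈ Finset.range J, C (T j) * X 0 ^ (j + 1) : MvPowerSeries (Fin 2) k) = 0 := by
  classical
  intro e he
  rw [map_sum]
  refine Finset.sum_eq_zero fun j _ => ?_
  rw [coeff_C_mul, coeff_X_pow, if_neg, mul_zero]
  rintro rfl
  simp at he

/-- `Ψ_J(0) = 0`. -/
theorem constantCoeff_psi (J : ℕ) (T : ℕ → k) :
    constantCoeff (∑ j ∈ Finset.range J, C (T j) * X 0 ^ (j + 1) : MvPowerSeries (Fin 2) k) = 0 := by
  rw [map_sum]
  refine Finset.sum_eq_zero fun j _ => ?_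
  rw [map_mul, map_pow, constantCoeff_X, zero_pow (Nat.succ_ne_zero j), mul_zero]

/-- The recursion `Ψ_{J+1}(T) = x · Ψ_J(T ∘ succ) + T₀ x`. -/
theorem psi_succ (J : ℕ) (T : ℕ → k) :
    (∑ j ∈ Finset.range (J + 1), C (T j) * X 0 ^ (j + 1) : MvPowerSeries (Fin 2) k) =
      X 0 * (∑ j ∈ Finset.range J, C (T (j + 1)) * X 0 ^ (j + 1)) + C (T 0) * X 0 := by
  rw [Finset.sum_range_succ', Finset.mul_sum, zero_add, pow_one]
  congr 1
  refine Finset.sum_congr rfl fun j _ => ?_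
  ring

/-- `t x` has no `y`-monomials. -/
theorem noY_C_mul_X (t : k) :
    ∀ e : Fin 2 →₀ ℕ, e 1 ≠ 0 → coeff e (C t * X 0 : MvPowerSeries (Fin 2) k) = 0 := by
  classical
  intro e he
  rw [coeff_C_mul, coeff_X, if_neg, mul_zero]
  rintro rfl
  simp at he

/-- The linear part of a shear by a series in `x` only has determinant `1`. -/
theorem det_shear {ψ : MvPowerSeries (Fin 2) k} (hψ : ∀ e : Fin 2 →₀ ℕ, e 1 ≠ 0 → coeff e ψ = 0) :
    (Matrix.of fun i j => coeff (Finsupp.single j 1)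
      ((![X 0, X 1 + ψ] : Fin 2 → MvPowerSeries (Fin 2) k) i)).det = 1 := by
  classical
  rw [Matrix.det_fin_two]
  simp [coeff_index_single_X, FormalShear.coeff_single_one_of_noY hψ]

/-! ### The blow-ups `σ_J = (x, x^J y)` and the shears -/

/-- `(x, x^J y)` is substitutable. -/
theorem hasSubst_blowJ (J : ℕ) :
    HasSubst (![X 0, X 0 ^ J * X 1] : Fin 2 → MvPowerSeries (Fin 2) k) :=
  hasSubst_of_constantCoeff_zero fun i => by fin_cases i <;> simp [constantCoeff_X]

/-- `(x, x^0 y)` is the identity. -/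
theorem subst_blowJ_zero (φ : MvPowerSeries (Fin 2) k) :
    subst (![X 0, X 0 ^ 0 * X 1] : Fin 2 → MvPowerSeries (Fin 2) k) φ = φ := by
  have h : (![X 0, X 0 ^ 0 * X 1] : Fin 2 → MvPowerSeries (Fin 2) k) = X := by
    funext s
    fin_cases s
    · rfl
    · show (X 0 ^ 0 * X 1 : MvPowerSeries (Fin 2) k) = X 1
      rw [pow_zero, one_mul]
  rw [h, subst_self]
  rfl

/-- ITERATING `(x, x y)`: `(x, x y)` followed by `(x, x^J y)` is `(x, x^{J+1} y)`. -/
theorem blowJ_blow (J : ℕ) (φ : MvPowerSeries (Fin 2) k) :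
    subst (![X 0, X 0 ^ J * X 1] : Fin 2 → MvPowerSeries (Fin 2) k)
        (subst (![X 0, X 0 * X 1] : Fin 2 → MvPowerSeries (Fin 2) k) φ) =
      subst (![X 0, X 0 ^ (J + 1) * X 1] : Fin 2 → MvPowerSeries (Fin 2) k) φ := by
  have hb := (PlaneGerm.hasSubst_blow (k := k))
  have hJ := hasSubst_blowJ (k := k) J
  rw [subst_comp_subst_apply hb hJ]
  congr 1
  funext s
  fin_cases s
  · show subst ![X 0, X 0 ^ J * X 1] (X 0 : MvPowerSeries (Fin 2) k) = X 0
    rw [subst_X hJ]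
    rfl
  · show subst ![X 0, X 0 ^ J * X 1] (X 0 * X 1 : MvPowerSeries (Fin 2) k) = X 0 ^ (J + 1) * X 1
    rw [subst_mul hJ, subst_X hJ, subst_X hJ]
    show (X 0 * (X 0 ^ J * X 1) : MvPowerSeries (Fin 2) k) = X 0 ^ (J + 1) * X 1
    ring

/-- COMMUTATION: the shear by `x ψ` followed by `(x, x y)` is `(x, x y)` followed by the shear by `ψ`,
for `ψ` in `x` only (both are `(x, x y + x ψ)`). -/
theorem blow_shear {ψ : MvPowerSeries (Fin 2) k} (hψ : ∀ e : Fin 2 →₀ ℕ, e 1 ≠ 0 → coeff e ψ = 0)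
    (hψ0 : constantCoeff ψ = 0) (φ : MvPowerSeries (Fin 2) k) :
    subst (![X 0, X 0 * X 1] : Fin 2 → MvPowerSeries (Fin 2) k) (subst ![X 0, X 1 + X 0 * ψ] φ) =
      subst ![X 0, X 1 + ψ] (subst (![X 0, X 0 * X 1] : Fin 2 → MvPowerSeries (Fin 2) k) φ) := by
  have hb := (PlaneGerm.hasSubst_blow (k := k))
  have hxψ0 : constantCoeff (X 0 * ψ) = 0 := by rw [map_mul, constantCoeff_X, zero_mul]
  have h1 := FormalShear.hasSubst_shear hxψ0
  have h2 := FormalShear.hasSubst_shear hψ0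
  rw [subst_comp_subst_apply h1 hb, subst_comp_subst_apply hb h2]
  congr 1
  funext s
  fin_cases s
  · show subst ![X 0, X 0 * X 1] (X 0 : MvPowerSeries (Fin 2) k) = subst ![X 0, X 1 + ψ] (X 0)
    rw [subst_X hb, subst_X h2]
    rfl
  · show subst ![X 0, X 0 * X 1] (X 1 + X 0 * ψ : MvPowerSeries (Fin 2) k) =
      subst ![X 0, X 1 + ψ] (X 0 * X 1)
    rw [subst_add hb, subst_mul hb, subst_X hb, subst_X hb, subst_mul h2, subst_X h2, subst_X h2,
      FormalShear.subst_eq_self_of_noY hb rfl hψ]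
    show (X 0 * X 1 + X 0 * ψ : MvPowerSeries (Fin 2) k) = X 0 * (X 1 + ψ)
    ring

/-- THE ITERATED STRICT TRANSFORM: after the shear by `Ψ_J`, the blow-up `(x, x^J y)` of `h 0` is
`x^{J m} · h J`. -/
theorem iterate (m : ℕ) : ∀ (J : ℕ) (h : ℕ → MvPowerSeries (Fin 2) k) (T : ℕ → k),
    (∀ j, subst (PlaneGerm.dirChart (T j)) (h j) = X 0 ^ m * h (j + 1)) →
    subst (![X 0, X 0 ^ J * X 1] : Fin 2 → MvPowerSeries (Fin 2) k)
        (subst ![X 0, X 1 + ∑ j ∈ Finset.range J, C (T j) * X 0 ^ (j + 1)] (h 0)) =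
      X 0 ^ (J * m) * h J := by
  intro J
  induction J with
  | zero =>
    intro h T _
    rw [Finset.sum_range_zero, FormalShear.shear_zero, subst_blowJ_zero, zero_mul, pow_zero, one_mul]
  | succ J ih =>
    intro h T hstep
    have hT' : subst (![X 0, X 0 ^ J * X 1] : Fin 2 → MvPowerSeries (Fin 2) k)
        (subst ![X 0, X 1 + ∑ j ∈ Finset.range J, C (T (j + 1)) * X 0 ^ (j + 1)] (h 1)) =
          X 0 ^ (J * m) * h (J + 1) :=
      ih (fun j => h (j + 1)) (fun j => T (j + 1)) (fun j => hstep (j + 1))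
    have hψ := noY_psi J (fun j => T (j + 1))
    have hψ0 := constantCoeff_psi J (fun j => T (j + 1))
    have hxψ0 : constantCoeff (X 0 * ∑ j ∈ Finset.range J, C (T (j + 1)) * X 0 ^ (j + 1) :
        MvPowerSeries (Fin 2) k) = 0 := by
      rw [map_mul, constantCoeff_X, zero_mul]
    have hc0 : constantCoeff (C (T 0) * X 0 : MvPowerSeries (Fin 2) k) = 0 := by
      rw [map_mul, constantCoeff_X, mul_zero]
    have h0 : subst (PlaneGerm.dirChart (T 0)) (h 0) = X 0 ^ m * h 1 := hstep 0
    rw [psi_succ, ← FormalShear.shear_shear (noY_C_mul_X (T 0)) hxψ0 hc0, ← blowJ_blow,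
      blow_shear hψ hψ0, ← PlaneGerm.subst_dirChart, h0,
      subst_X_pow_mul (FormalShear.hasSubst_shear hψ0) rfl,
      subst_X_pow_mul (hasSubst_blowJ J) rfl, hT', ← mul_assoc, ← pow_add, Nat.succ_mul, add_comm]

/-! ### Coefficients and weighted orders through `σ_J = (x, x^J y)` -/

/-- `(x, x^J y)` sends the monomial `(p, q)` to the monomial `(p + J q, q)`. -/
theorem prod_pow_blowJ (J : ℕ) (d : Fin 2 →₀ ℕ) :
    (d.prod fun s n => (![X 0, X 0 ^ J * X 1] : Fin 2 → MvPowerSeries (Fin 2) k) s ^ n) =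
      monomial (Finsupp.single 0 (d 0 + J * d 1) + Finsupp.single 1 (d 1)) 1 := by
  rw [Finsupp.prod_pow, Fin.prod_univ_two]
  show (X 0 : MvPowerSeries (Fin 2) k) ^ d 0 * (X 0 ^ J * X 1) ^ d 1 = _
  rw [mul_pow, ← pow_mul, ← mul_assoc, ← pow_add, X_pow_eq, X_pow_eq, monomial_mul_monomial,
    one_mul]

/-- The exponent map `(p, q) ↦ (p + J q, q)` is injective. -/
theorem injective_exp_blowJ (J : ℕ) :
    Function.Injective (fun d : Fin 2 →₀ ℕ =>
      (Finsupp.single 0 (d 0 + J * d 1) + Finsupp.single 1 (d 1) : Fin 2 →₀ ℕ)) := by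
  intro d d' h
  have h0 := congrArg (fun f : Fin 2 →₀ ℕ => f 0) h
  have h1 := congrArg (fun f : Fin 2 →₀ ℕ => f 1) h
  simp at h0 h1
  ext i
  fin_cases i
  · show d 0 = d' 0
    rw [h1] at h0
    exact Nat.add_right_cancel h0
  · exact h1

/-- Coefficients along `(x, x^J y)`: `coeff (p + J q, q) g(x, x^J y) = coeff (p, q) g`. -/
theorem coeff_subst_blowJ (J : ℕ) (g : MvPowerSeries (Fin 2) k) (d : Fin 2 →₀ ℕ) :
    coeff (Finsupp.single 0 (d 0 + J * d 1) + Finsupp.single 1 (d 1))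
      (subst (![X 0, X 0 ^ J * X 1] : Fin 2 → MvPowerSeries (Fin 2) k) g) = coeff d g :=
  PlaneGerm.coeff_subst_of_prod_eq_monomial (hasSubst_blowJ J) _ (injective_exp_blowJ J)
    (prod_pow_blowJ J) g d

/-- WEIGHTED ORDER THROUGH `(x, x^J y)`: if `g(x, x^J y) = x^{J m} · h'` with `ord h' = m` then the
`(1, J+1)`-weighted order of `g` is `≥ (J + 1) m` (a monomial `(p, q)` of `g` gives the monomial
`(p + J q, q)` of `g(x, x^J y)`, of degree `p + (J+1) q ≥ ord (x^{J m} h') = (J+1) m`). -/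
theorem le_weightedOrder_of_blowJ {J m : ℕ} {g h' : MvPowerSeries (Fin 2) k} (hh' : h'.order = m)
    (hg : subst (![X 0, X 0 ^ J * X 1] : Fin 2 → MvPowerSeries (Fin 2) k) g = X 0 ^ (J * m) * h') :
    (((J + 1) * m : ℕ) : ℕ∞) ≤ weightedOrder ![1, J + 1] g := by
  apply nat_le_weightedOrder
  intro d hd
  rw [WeightedShear.weight_fin_two] at hd
  by_contra hne
  have h1 := coeff_subst_blowJ J g d
  rw [hg] at h1
  have h2 : (X 0 ^ (J * m) * h').order ≤
      ((Finsupp.single 0 (d 0 + J * d 1) + Finsupp.single 1 (d 1) : Fin 2 →₀ ℕ).degree : ℕ∞) :=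
    order_le (by rw [h1]; exact hne)
  rw [order_mul, X_pow_eq, order_monomial_of_ne_zero one_ne_zero, hh', Finsupp.degree_single,
    map_add, Finsupp.degree_single, Finsupp.degree_single] at h2
  have h3 : J * m + m ≤ d 0 + J * d 1 + d 1 := by exact_mod_cast h2
  have h4 : (J + 1) * m = J * m + m := Nat.succ_mul J m
  have h5 : (J + 1) * d 1 = J * d 1 + d 1 := Nat.succ_mul J (d 1)
  omega

/-! ### Assembly -/

/-- CONTACT `≥ N` FOR EVERY `N`: the shear by `Ψ_{N-1}` is a legal coordinate change in which `h 0`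
has `(1, N)`-weighted order `≥ N m`. -/
theorem contact {m : ℕ} {h : ℕ → MvPowerSeries (Fin 2) k} {T : ℕ → k} (hord : ∀ j, (h j).order = m)
    (hstep : ∀ j, subst (PlaneGerm.dirChart (T j)) (h j) = X 0 ^ m * h (j + 1)) (N : ℕ) :
    ∃ Φ : Fin 2 → MvPowerSeries (Fin 2) k, (∀ i, constantCoeff (Φ i) = 0) ∧
      IsUnit (Matrix.det (Matrix.of fun i j => coeff (Finsupp.single j 1) (Φ i))) ∧
      ((N * m : ℕ) : ℕ∞) ≤ weightedOrder ![1, N] (subst Φ (h 0)) := by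
  refine ⟨![X 0, X 1 + ∑ j ∈ Finset.range (N - 1), C (T j) * X 0 ^ (j + 1)],
    FormalShear.constantCoeff_shear (constantCoeff_psi _ T), ?_, ?_⟩
  · rw [det_shear (noY_psi _ T)]
    exact isUnit_one
  · cases N with
    | zero => simp
    | succ J =>
      rw [Nat.add_sub_cancel]
      exact le_weightedOrder_of_blowJ (hord J) (iterate m J h T hstep)

/-- The `x`-linear coefficient of `x · W` is `W(0)`. -/
theorem coeff_single_zero_X_mul (W : MvPowerSeries (Fin 2) k) :
    coeff (Finsupp.single 0 1) (X 0 * W) = constantCoeff W := by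
  -- adapted from `Literature.AlgebraicGeometry.Resolution.FormalShear.coeff_single_one_X_mul`
  classical
  rw [X_def, coeff_monomial_mul, if_pos le_rfl, one_mul, tsub_self, coeff_zero_eq_constantCoeff_apply]

/-- `∂L/∂y(0) ≠ 0`: were the tangent of `L` vertical (`L = a x + O(2)`, `a ≠ 0`), the strict transform
`h₁` of `h₀ = u · L^m` at a point of finite slope would be a unit, not of order `m ≥ 1`. -/
theorem coeff_y_ne_zero {m : ℕ} (hm : 1 ≤ m) {h0 h1 u L : MvPowerSeries (Fin 2) k} {t : k}
    (h1ord : h1.order = m) (hstep : subst (PlaneGerm.dirChart t) h0 = X 0 ^ m * h1)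
    (hu : constantCoeff u ≠ 0) (hL0 : constantCoeff L = 0)
    (hLi : ∃ i, coeff (Finsupp.single i 1) L ≠ 0) (hEq : h0 = u * L ^ m) :
    coeff (Finsupp.single 1 1) L ≠ 0 := by
  classical
  intro hL1
  obtain ⟨i, hi⟩ := hLi
  have hLx : coeff (Finsupp.single 0 1) L ≠ 0 := by
    fin_cases i
    · exact hi
    · exact absurd hL1 hi
  have hΦ := PlaneGerm.hasSubst_dirChart (k := k) t
  -- `L(x, x(t + y)) = x · U` with `U(0) = ∂L/∂x(0)`
  obtain ⟨U, hU⟩ : (X 0 : MvPowerSeries (Fin 2) k) ∣ subst (PlaneGerm.dirChart t) L := by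
    have h := PlaneGerm.X_pow_dvd_subst hΦ (PlaneGerm.X_dvd_dirChart t) (b := L) (m := 1)
      (by rw [Nat.cast_one]; exact one_le_order_iff_constCoeff_eq_zero.mpr hL0)
    rwa [pow_one] at h
  have hU0 : constantCoeff U = coeff (Finsupp.single 0 1) L := by
    have h := CobordantArc.coeff_degree_one_subst (PlaneGerm.dirChart t)
      (PlaneGerm.constantCoeff_dirChart t) L (Finsupp.single 0 1) (Finsupp.degree_single _ _)
    rw [hU, Fin.sum_univ_two, hL1, zero_mul, add_zero, PlaneGerm.dirChart_zero,
      coeff_index_single_self_X, mul_one, coeff_single_zero_X_mul] at h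
    exact h
  -- `h₁ = u(x, x(t + y)) · U^m` would be a unit
  have h1eq : X 0 ^ m * h1 = X 0 ^ m * (subst (PlaneGerm.dirChart t) u * U ^ m) := by
    rw [← hstep, hEq, subst_mul hΦ, subst_pow hΦ, hU, mul_pow]
    ring
  have hc : constantCoeff h1 = 0 := by
    apply one_le_order_iff_constCoeff_eq_zero.mp
    rw [h1ord]
    exact_mod_cast hm
  rw [mul_left_cancel₀ (pow_ne_zero m (FormalCoordChange.X_ne_zero' (0 : Fin 2))) h1eq, map_mul,
    map_pow, FormalShear.constantCoeff_subst_eq_of_constantCoeff_eq_zero _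
      (PlaneGerm.constantCoeff_dirChart t), hU0] at hc
  exact mul_ne_zero hu (pow_ne_zero m hLx) hc

end PersistentOrderPower

open PersistentOrderPower in
/-- PERSISTENT ORDER ⇒ `m`-TH POWER OF A SMOOTH GERM (any field).  If `h₀, h₁, … ∈ k[[x, y]]` all have
order `m ≥ 1` and each `h_{j+1}` is the strict transform of `h_j` at the exceptional point of slope `T j`
(`h_j(x, x(T_j + y)) = x^m h_{j+1}`), then `h₀ = u · L^m` with `u` a unit, `L(0) = 0`, `∂L/∂y(0) ≠ 0`:
persistence of the multiplicity gives contact `≥ N` with the sheared coordinate `y + ∑_{j<N-1} T_j x^{j+1}`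
for every `N`, and unbounded contact is an exact `m`-th power (`stub_contactApprox`,
`stub_approxPowerExact`). -/
theorem stub_persistentOrderPower : ∀ (k : Type) [Field k] (m : ℕ), 1 ≤ m →
    ∀ (h : ℕ → MvPowerSeries (Fin 2) k) (T : ℕ → k),
      (∀ j, (h j).order = m) →
      (∀ j, MvPowerSeries.subst (PlaneGerm.dirChart (T j)) (h j) = MvPowerSeries.X 0 ^ m * h (j + 1)) →
      ∃ (u L : MvPowerSeries (Fin 2) k), MvPowerSeries.constantCoeff u ≠ 0 ∧ MvPowerSeries.constantCoeff L = 0 ∧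
        MvPowerSeries.coeff (Finsupp.single 1 1) L ≠ 0 ∧ h 0 = u * L ^ m := by
  intro k _ m hm h T hord hstep
  obtain ⟨u, L, hu, hL0, hLi, hEq⟩ := stub_approxPowerExact k (h 0) m (hord 0)
    (stub_contactApprox k (h 0) m (hord 0) (contact hord hstep))
  exact ⟨u, L, hu, hL0, coeff_y_ne_zero hm (hord 1) (hstep 0) hu hL0 hLi hEq, hEq⟩

end Summit.ResolutionOfSingularities.ResolutionOfSingularities.Theorems
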